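import Summits.ABC.IUTFork.Cor312LicencePermutedMovers
import Summits.ABC.IUTFork.Cor312LicenceBallFibreMovers
import HarnessLib

/-!
# [IUTchIII] Cor. 3.12 — the (xi-f) inclusion at a packet of BALL places of ARBITRARY (non-uniform) indices from the PAIR CONDITION
# `e_y·(e_w·min(D_w, D_y) + 1) ≤ e_y·m_q(w) + j·e_w·(e_y − 1)` at every pair of places `(w, y)` over `p`

PROOF-ONLY support piece (D-0012; 0 definitions, 0 `Prop` facts) of the abc-iut cell (prover abc-iut-w4-d006, gen 6; D-0079 R-W
«WINDOW Θ-SIDE INEQUALITY», row «W:T1½-PAIRS BALL-FIBRES lane=U», part 1 of 3 = the INHABITED leg). TAKES NO SIDE on [IUTchIII]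
Cor. 3.12 (S. Mochizuki, *Inter-universal Teichmüller theory III*, kurims manuscript, Cor. 3.12 p. 173 l. 41 – p. 174 l. 19; Step
(xi-f) p. 184 l. 26–29; Thm. 3.11 (i) p. 154) or on any author: statements about OUR typed objects (abc-iut-c312-5's `logShellsDH`,
abc-iut-c312-3's sharp setting `settingDHVolSharp`, Dupuy–Hilado's typed (Ind1)/(Ind2)); the per-packet hull reading is a
STRONGER-THAN-PRINT form; nothing here bears on the printed GLOBAL inequality. typed ≠ proved; instantiated ≠ endorsed.

THE POINT. Gen 5's `qRegion_subset_thetaHull_settingDHVolSharp_of_tame_pairs` (p450749) decides the inhabited side of the (xi-f)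
inclusion at a fibre of ARBITRARY mixed ramification indices by a condition on PAIRS of places, but its movers are the TAME ones
(`p > 2`, `e_x ≤ p − 2`). abc-iut-D1-prv observed (p454898, `Cor312LicenceBallFibreMovers`) that tameness enters those movers at exactly
one point — `log_p(𝒪_x^×) = 𝔪_x = {‖y‖ ≤ ‖ϖ_x‖}` — and re-ran them with that equality as the HYPOTHESIS (a «ball place»), which also
holds on D-0079 R-W's boundary stratum U1½ (`e_x = p − 1`, `ζ_p ∉ K_x`; abc-iut-w6-d060 `TorsionFree.logUnits_eq_closedBall_of_le_pred`).
This file is the PAIR criterion's inhabited leg over those ball movers: same slot choice, same integer predicate, NO `p > 2` and NO bound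
on the indices beyond the ball hypothesis at every place of the fibre.

WHAT IS PROVED (namespace `Summit.ABC.IUTFork.Thm311.Real`): **`qRegion_subset_thetaHull_settingDHVolSharp_of_ball_pairs`.** At a prime
`p` whose places `x | p` are all BALL places (uniformizers `ϖ_x` with `log_p(𝒪_x^×) = {‖y‖ ≤ ‖ϖ_x‖}`; indices `e_x := e(x|p)` ARBITRARY and
possibly different), label `j = i+1`, ideles with `‖t_{Θ,j,x}‖ = ‖ϖ_x‖^{m_Θ(x)}`, `‖t_{q,x}‖ = ‖ϖ_x‖^{m_q(x)}` (any integers), and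
`D_x := (m_Θ(x) − 1) div e_x`: IF at every PAIR `(w, y)` of places over `p`

  `e_y·(e_w·min(D_w, D_y) + 1) ≤ e_y·m_q(w) + j·e_w·(e_y − 1)`,

THEN the q-pilot region at `(j, p)` lies in `ⁿ˒°𝒰_{j,p}`. MECHANISM (gen 5's `…_of_permTargets`, p449761): at the summand
`v⃗ = (v_0, …, v_{j−1}, w)` let `y₀` be a LEAST-ramified companion; if `D_w ≤ D_{y₀}` the Θ-idele stays in the last slot (`t_{Θ,j,w}`
reaches the top of its `p`-level, `‖p‖^{D_w}·‖ϖ_w‖`, every companion donates `‖p‖⁻¹‖ϖ_{v_a}‖ ≥ ‖p‖⁻¹‖ϖ_{y₀}‖`), else the Θ-idele is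
carried by the slot of `y₀` after an (Ind1)-permutation; in both cases the pair condition at `(w, y₀)` is exactly what the product of the
targets needs. The movers are abc-iut-D1-prv's ball one-factor supplies (`exists_mem_ismDH_norm_one_ge_of_ball`,
`exists_mem_ismDH_norm_labelIdele_ge_of_ball`). For a fibre with ONE index `e` the pairs reduce to `y = w` and the condition to
abc-iut-D1-prv's `…_of_ball_orders` window `e·D_w + 1 − j(e−1) ≤ m_q(w)` (p454898); at tame fibres (`p > 2`, `e_x ≤ p − 2`, where the ball
equality is abc-iut-w5-d180's `logUnits_eq_closedBall_of_tame`) it is gen 5's p450749 verbatim.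
HONEST SCOPE: OUR sharp containers (Θ-regions constant in `m`), Dupuy–Hilado's typed (Ind1)/(Ind2) acting independently on every
(capsule slot, place) as abc-iut-c312-1 typed Thm. 3.11 (i); STRONGER-THAN-PRINT hull reading; nothing about the author's intended hull,
the M-level `Ism`, or the printed GLOBAL inequality. [cite: Mochizuki2012, IUTchIII Thm. 3.11 (i) p. 154, Cor. 3.12 p. 173–174]
[cite: DupuyHilado2025, §3.9, §4.7, §4.9] [cite: WeilBNT1967, Ch. II §2, Th. 1] [claim: Mochizuki2012, status: disputed].
-/

noncomputable section

open Set Metric Function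
open scoped Pointwise

namespace Summit.ABC.IUTFork.Thm311.Real

open Cor312 Cor312.Setting Cor312Vol Literature.IUT.LogThetaLattice Literature.IUT.LogVolume NumberField IsDedekindDomain
open Literature.NumberTheory.NumberFields Literature.NumberTheory.GaloisRepresentations.Ultrametric

variable {F : Type} [Field F] [NumberField F] (X : PilotData F) {logv : PadicLogs F} (hlog : LogvAnalytic logv)
  (M : Type) [Field M] [NumberField M]
  (archPk : ∀ (j : (thetaIndex X).Label) (vQ : (thetaIndex X).VQ), Set ((logShellsDH X logv).Packet j vQ))
  (archSub : ∀ (j : (thetaIndex X).Label) (v : (thetaIndex X).V),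
    Set ((logShellsDH X logv).Packet j ((thetaIndex X).over v)))
  (Ψ : ℤ → ∀ v : (thetaIndex X).V, v ∈ (thetaIndex X).Vbad → Set ((logShellsDH X logv).StarPacket v))
  (act : ℤ → ∀ v : (thetaIndex X).V, v ∈ (thetaIndex X).Vbad →
    (logShellsDH X logv).StarPacket v → Module.End ℚ ((logShellsDH X logv).StarPacket v))
  (Mmod : ℤ → ∀ j : (thetaIndex X).LabelStar, Set ((logShellsDH X logv).GlobalPacket j.1))
  (region : ℤ → ∀ j : (thetaIndex X).LabelStar, FinDivisor M → ∀ vQ : (thetaIndex X).VQ,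
    Set ((logShellsDH X logv).Packet j.1 vQ))
  (n : ℤ) {HT : Type} {LogLink : HT → HT → Type} {IsFull : ∀ {s t : HT}, LogLink s t → Prop}
  (lat : LGPGaussianLogThetaLattice LogLink IsFull)
  {Frd : Type} {IsoF : Frd → Frd → Type} {Ob : Frd → Type} {realify : Frd → Frd} {Strip : Type}
  {IsoS : Strip → Strip → Type} {Mv : ∀ v : (thetaIndex X).V, v ∈ (thetaIndex X).Vbad → Type}
  [∀ v h, Monoid (Mv v h)]
  (sig : GlobalLGPFrobenioidSignature (thetaIndex X).lstar (thetaIndex X).V (· ∈ (thetaIndex X).Vbad)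
    Frd IsoF Ob realify Strip IsoS Mv)
  (split : SplittingMonoids Mv) {ObΔ : Type} {N : ∀ v : (thetaIndex X).V, v ∈ (thetaIndex X).Vbad → Type}
  [∀ v h, Monoid (N v h)] (qData : QPilotData ObΔ N)
  (tq : ∀ (pp : Nat.Primes) (x : (thetaIndex X).Fibre (.inr pp)), haveI : Fact (pp : ℕ).Prime := ⟨pp.2⟩; kOf X pp.1 x)
  (t : ∀ (pp : Nat.Primes) (_ : Fin X.lstar) (x : (thetaIndex X).Fibre (.inr pp)),
    haveI : Fact (pp : ℕ).Prime := ⟨pp.2⟩; kOf X pp.1 x)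
  (htq0 : ∀ pp x, tq pp x ≠ 0)
  (htq1 : ∀ (pp : Nat.Primes) (x : (thetaIndex X).Fibre (.inr pp)),
    haveI : Fact (pp : ℕ).Prime := ⟨pp.2⟩; placeOf X pp.1 x ∉ X.S → ‖tq pp x‖ = 1)

/-- **THE (xi-f) INCLUSION AT A PACKET OF BALL PLACES OF ARBITRARY INDICES FROM THE PAIR CONDITION.** Every place `x | p` a ball
place (`log_p(𝒪_x^×) = {‖y‖ ≤ ‖ϖ_x‖}`, `ϖ_x` a uniformizer) with index `e_x` (the `e_x` may DIFFER); label `j = i+1`;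
`‖t_{Θ,j,x}‖ = ‖ϖ_x‖^{m_Θ(x)}`, `‖t_{q,x}‖ = ‖ϖ_x‖^{m_q(x)}`; `D_x := (m_Θ(x) − 1) div e_x`. If
`e_y·(e_w·min(D_w, D_y) + 1) ≤ e_y·m_q(w) + j·e_w·(e_y − 1)` for EVERY pair of places `(w, y)` over `p`, then the q-pilot region at `(j, p)`
lies in `ⁿ˒°𝒰_{j,p}` (slot choice at each summand: the last slot, or the slot of a least-ramified companion, according to `D_w ≤ D_{y₀}` or
not). Any prime `p`; no tameness hypothesis beyond the ball. [cite: Mochizuki2012, IUTchIII Thm. 3.11 (i) p. 154]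
[cite: DupuyHilado2025, §3.9, §4.7, §4.9] [cite: WeilBNT1967, Ch. II §2, Th. 1] [claim: Mochizuki2012, status: disputed] -/
theorem qRegion_subset_thetaHull_settingDHVolSharp_of_ball_pairs (i : Fin (thetaIndex X).lstar) (pp : Nat.Primes)
    (E : (thetaIndex X).Fibre (.inr pp) → ℕ)
    (ϖ : haveI : Fact (pp : ℕ).Prime := ⟨pp.2⟩; ∀ x : (thetaIndex X).Fibre (.inr pp), (kOf X pp.1 x)ˣ)
    (hfib : haveI : Fact (pp : ℕ).Prime := ⟨pp.2⟩
      ∀ x : (thetaIndex X).Fibre (.inr pp),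
        (placeOf X pp.1 x).asIdeal.ramificationIdx ℤ = E x ∧ IsUniformizer (ϖ x) ∧
          logUnits (kOf X pp.1 x) = closedBall (0 : kOf X pp.1 x) ‖(ϖ x : kOf X pp.1 x)‖)
    (mΘ mq : (thetaIndex X).Fibre (.inr pp) → ℤ)
    (hΘ : haveI : Fact (pp : ℕ).Prime := ⟨pp.2⟩
      ∀ x : (thetaIndex X).Fibre (.inr pp), ‖t pp i x‖ = ‖(ϖ x : kOf X pp.1 x)‖ ^ mΘ x)
    (hq : haveI : Fact (pp : ℕ).Prime := ⟨pp.2⟩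
      ∀ x : (thetaIndex X).Fibre (.inr pp), ‖tq pp x‖ = ‖(ϖ x : kOf X pp.1 x)‖ ^ mq x)
    (hpair : ∀ w y : (thetaIndex X).Fibre (.inr pp),
      (E y : ℤ) * ((E w : ℤ) * min ((mΘ w - 1) / (E w : ℤ)) ((mΘ y - 1) / (E y : ℤ)) + 1) ≤
        (E y : ℤ) * mq w + ((i : ℕ) + 1 : ℕ) * (E w : ℤ) * ((E y : ℤ) - 1)) :
    (settingDHVolSharp X hlog M archPk archSub Ψ act Mmod region n lat sig split qData tq t htq0 htq1).qRegion
        (labelSucc i) (.inr pp) ⊆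
      (settingDHVolSharp X hlog M archPk archSub Ψ act Mmod region n lat sig split qData tq t htq0 htq1).thetaHull
        (labelSucc i) (.inr pp) := by
  haveI hF : Fact (pp : ℕ).Prime := ⟨pp.2⟩
  classical
  have hp1 : (1 : ℝ) ≤ (pp : ℕ) := by exact_mod_cast pp.2.one_lt.le
  have hp0 : (0 : ℝ) < (pp : ℕ) := by exact_mod_cast pp.2.pos
  -- invariants at the places over `p`
  have heK : ∀ x : (thetaIndex X).Fibre (.inr pp), absRamificationIdx (pp : ℕ) (kOf X pp.1 x) = E x := fun x =>
    (absRamificationIdx_rescaledCompletion F (pp : ℕ) (placeOf X pp.1 x) (natCast_mem_placeOf X pp.1 x)).trans (hfib x).1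
  have hE0 : ∀ x, 0 < E x := fun x => by rw [← heK x]; exact absRamificationIdx_pos _ _
  have hE0R : ∀ x, (0 : ℝ) < (E x : ℝ) := fun x => by exact_mod_cast hE0 x
  have hnormϖ : ∀ x : (thetaIndex X).Fibre (.inr pp), ‖(ϖ x : kOf X pp.1 x)‖ = ((pp : ℕ) : ℝ) ^ (-(1 / (E x : ℝ))) := by
    intro x
    rw [norm_eq_rpow_of_isUniformizer (pp : ℕ) (kOf X pp.1 x) (hfib x).2.1, heK x]
  have hnormp : ‖((pp : ℕ) : ℚ_[pp])‖ = ((pp : ℕ) : ℝ)⁻¹ := Padic.norm_p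
  -- the two targets (`D_x := (m_Θ(x) − 1) div e_x` is the `p`-level of `t_{Θ,j,x}`), as real powers of `p`
  let R : (thetaIndex X).Fibre (.inr pp) → ℝ := fun x => ‖((pp : ℕ) : ℚ_[pp])‖⁻¹ * ‖(ϖ x : kOf X pp.1 x)‖
  let Nn : (thetaIndex X).Fibre (.inr pp) → ℝ := fun x =>
    ‖((pp : ℕ) : ℚ_[pp])‖ ^ ((mΘ x - 1) / (E x : ℤ)) * ‖(ϖ x : kOf X pp.1 x)‖
  have hR_eq : ∀ x, R x = ((pp : ℕ) : ℝ) ^ (1 - 1 / (E x : ℝ)) := by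
    intro x
    show ‖((pp : ℕ) : ℚ_[pp])‖⁻¹ * ‖(ϖ x : kOf X pp.1 x)‖ = _
    rw [hnormp, inv_inv, hnormϖ x, sub_eq_add_neg, Real.rpow_add hp0, Real.rpow_one]
  have hN_eq : ∀ x, Nn x = ((pp : ℕ) : ℝ) ^ (-(((mΘ x - 1) / (E x : ℤ) : ℤ) : ℝ) - 1 / (E x : ℝ)) := by
    intro x
    show ‖((pp : ℕ) : ℚ_[pp])‖ ^ ((mΘ x - 1) / (E x : ℤ)) * ‖(ϖ x : kOf X pp.1 x)‖ = _
    rw [hnormp, hnormϖ x, inv_zpow', ← Real.rpow_intCast, ← Real.rpow_add hp0]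
    congr 1
    push_cast
    ring
  have hR0 : ∀ x, 0 ≤ R x := fun x => by rw [hR_eq x]; positivity
  have hN0 : ∀ x, 0 ≤ Nn x := fun x => by rw [hN_eq x]; positivity
  have hRpos : ∀ x, 0 < R x := fun x => by rw [hR_eq x]; positivity
  have hRmono : ∀ x y, E x ≤ E y → R x ≤ R y := by
    intro x y hxy
    rw [hR_eq, hR_eq]
    refine Real.rpow_le_rpow_of_exponent_le hp1 ?_
    have : (1 : ℝ) / (E y : ℝ) ≤ 1 / (E x : ℝ) := one_div_le_one_div_of_le (hE0R x) (by exact_mod_cast hxy)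
    linarith
  have hq_eq : ∀ x, ‖tq pp x‖ = ((pp : ℕ) : ℝ) ^ (-((mq x : ℝ) / (E x : ℝ))) := by
    intro x
    rw [hq x, hnormϖ x, ← Real.rpow_intCast, ← Real.rpow_mul hp0.le]
    congr 1
    ring
  -- the movers (abc-iut-D1-prv ball supplies, p454898)
  have hRmov : ∀ x : (thetaIndex X).Fibre (.inr pp), ∃ g ∈ ismDH logv x.1,
      R x ≤ ‖(presAt X hlog pp).φ x (g (((presAt X hlog pp).φ x).symm 1))‖ := fun x =>
    exists_mem_ismDH_norm_one_ge_of_ball X hlog pp x ⟨ϖ x, (hfib x).2.1, (hfib x).2.2, le_rfl⟩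
  have hNmov : ∀ x : (thetaIndex X).Fibre (.inr pp), ∃ g ∈ ismDH logv x.1,
      Nn x ≤ ‖(presAt X hlog pp).φ x (g (((presAt X hlog pp).φ x).symm (labelIdele X t pp (labelSucc i) x)))‖ := by
    intro x
    set a : ℝ := ‖(ϖ x : kOf X pp.1 x)‖ with ha
    have ha0 : 0 < a := norm_pos_iff.2 (ϖ x).ne_zero
    have ha1 : a < 1 := (hfib x).2.1.norm_lt_one
    have hae : a ^ E x = ((pp : ℕ) : ℝ)⁻¹ := by rw [ha, ← heK x]; exact norm_pow_absRamificationIdx (pp : ℕ) _ (hfib x).2.1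
    have hpnorm : ‖((pp : ℕ) : ℚ_[pp])‖ = a ^ (E x : ℤ) := by rw [Padic.norm_p, zpow_natCast, hae]
    have hediv : (E x : ℤ) * ((mΘ x - 1) / (E x : ℤ)) ≤ mΘ x - 1 := Int.mul_ediv_self_le (by exact_mod_cast (hE0 x).ne')
    have hemod : mΘ x - 1 < (E x : ℤ) * ((mΘ x - 1) / (E x : ℤ)) + E x := Int.lt_mul_ediv_self_add (by exact_mod_cast hE0 x)
    have hzle : ∀ A B : ℤ, a ^ A ≤ a ^ B ↔ B ≤ A := fun A B => zpow_le_zpow_iff_right_of_lt_one₀ ha0 ha1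
    have hzlt : ∀ A B : ℤ, a ^ A < a ^ B ↔ B < A := fun A B => zpow_lt_zpow_iff_right_of_lt_one₀ ha0 ha1
    refine exists_mem_ismDH_norm_labelIdele_ge_of_ball X hlog t pp (labelSucc i) x ((mΘ x - 1) / (E x : ℤ))
      ⟨ϖ x, (hfib x).2.2, ?_, ?_, rfl⟩
    · rw [labelIdele_labelSucc, hΘ x, hpnorm, ← zpow_mul, ← ha, ← zpow_add_one₀ ha0.ne', ← zpow_add₀ ha0.ne', hzlt]
      linarith
    · rw [labelIdele_labelSucc, hΘ x, hpnorm, ← zpow_mul, ← ha, ← zpow_add_one₀ ha0.ne', hzle]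
      linarith
  -- the slot choice at a summand: a least-ramified companion `y₀ = v_{a₀}`
  have hne : (Finset.univ : Finset (Fin ((i : ℕ) + 1))).Nonempty := Finset.univ_nonempty
  let a₀ : ((thetaIndex X).Caps (labelSucc i) → (thetaIndex X).Fibre (.inr pp)) → Fin ((i : ℕ) + 1) := fun e =>
    Classical.choose (Finset.exists_min_image Finset.univ
      (fun b : Fin ((i : ℕ) + 1) => E (e (Fin.castSucc (n := (i : ℕ) + 1) b))) hne)
  have ha₀ : ∀ (e : (thetaIndex X).Caps (labelSucc i) → (thetaIndex X).Fibre (.inr pp)) (b : Fin ((i : ℕ) + 1)),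
      E (e (Fin.castSucc (n := (i : ℕ) + 1) (a₀ e))) ≤ E (e (Fin.castSucc (n := (i : ℕ) + 1) b)) := fun e b =>
    (Classical.choose_spec (Finset.exists_min_image Finset.univ
      (fun b : Fin ((i : ℕ) + 1) => E (e (Fin.castSucc (n := (i : ℕ) + 1) b))) hne)).2 b (Finset.mem_univ b)
  let s : ((thetaIndex X).Caps (labelSucc i) → (thetaIndex X).Fibre (.inr pp)) → (thetaIndex X).Caps (labelSucc i) := fun e =>
    if (mΘ (e (Fin.last ((i : ℕ) + 1))) - 1) / (E (e (Fin.last ((i : ℕ) + 1))) : ℤ) ≤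
        (mΘ (e (Fin.castSucc (n := (i : ℕ) + 1) (a₀ e))) - 1) / (E (e (Fin.castSucc (n := (i : ℕ) + 1) (a₀ e))) : ℤ)
    then Fin.last ((i : ℕ) + 1) else Fin.castSucc (n := (i : ℕ) + 1) (a₀ e)
  refine qRegion_subset_thetaHull_settingDHVolSharp_of_permTargets X hlog M archPk archSub Ψ act Mmod region n lat sig split qData
    tq t htq0 htq1 (labelSucc i) pp R Nn hR0 hN0 hRmov hNmov s fun e => ?_
  -- the estimate at the summand `e`: `w` the last place, `y₀` the least-ramified companion
  set w := e (Fin.last ((i : ℕ) + 1)) with hw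
  set y₀ := e (Fin.castSucc (n := (i : ℕ) + 1) (a₀ e)) with hy₀
  set Dw : ℤ := (mΘ w - 1) / (E w : ℤ) with hDw
  set Dy : ℤ := (mΘ y₀ - 1) / (E y₀ : ℤ) with hDy
  -- split the product over the last slot and the companions
  have hsplit : (∏ a, (if a = s e then Nn (e a) else R (e a))) =
      (∏ b : Fin ((i : ℕ) + 1), (if Fin.castSucc (n := (i : ℕ) + 1) b = s e then Nn (e (Fin.castSucc (n := (i : ℕ) + 1) b))
        else R (e (Fin.castSucc (n := (i : ℕ) + 1) b)))) *
      (if Fin.last ((i : ℕ) + 1) = s e then Nn w else R w) := by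
    show (∏ a : Fin ((i : ℕ) + 1 + 1), (if a = s e then Nn (e a) else R (e a))) = _
    rw [Fin.prod_univ_castSucc]
  show ‖tq pp (e (Fin.last ((i : ℕ) + 1)))‖ ≤ _
  rw [hsplit, ← hw]
  -- the pair condition at `(w, y₀)`
  have h0 := hpair w y₀
  rw [← hDw, ← hDy] at h0
  have hpos : (0 : ℝ) < (E w : ℝ) * (E y₀ : ℝ) := mul_pos (hE0R w) (hE0R y₀)
  have hEw : (E w : ℝ) ≠ 0 := (hE0R w).ne'
  have hEy : (E y₀ : ℝ) ≠ 0 := (hE0R y₀).ne'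
  by_cases hcase : Dw ≤ Dy
  · -- the Θ-idele stays in the last slot; every companion donates at least `R y₀`
    have hs : s e = Fin.last ((i : ℕ) + 1) := if_pos hcase
    have hmin : min Dw Dy = Dw := min_eq_left hcase
    rw [hs, if_pos rfl]
    have hcomp : R y₀ ^ ((i : ℕ) + 1) ≤
        ∏ b : Fin ((i : ℕ) + 1), (if Fin.castSucc (n := (i : ℕ) + 1) b = Fin.last ((i : ℕ) + 1)
          then Nn (e (Fin.castSucc (n := (i : ℕ) + 1) b)) else R (e (Fin.castSucc (n := (i : ℕ) + 1) b))) := by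
      calc R y₀ ^ ((i : ℕ) + 1) = ∏ _b : Fin ((i : ℕ) + 1), R y₀ := by
            rw [Finset.prod_const, Finset.card_univ, Fintype.card_fin]
        _ ≤ _ := Finset.prod_le_prod (fun b _ => hR0 _) fun b _ => by
            rw [if_neg (Fin.castSucc_ne_last b)]
            exact hRmono _ _ (ha₀ e b)
    refine le_trans ?_ (mul_le_mul_of_nonneg_right hcomp (hN0 w))
    -- `‖t_q(w)‖ ≤ R(y₀)^{i+1} · N(w)` from the pair condition with `min = D_w`
    rw [hq_eq w, hR_eq y₀, hN_eq w, ← hDw, ← Real.rpow_natCast, ← Real.rpow_mul hp0.le, ← Real.rpow_add hp0]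
    refine Real.rpow_le_rpow_of_exponent_le hp1 ?_
    rw [hmin] at h0
    have hR' : (E y₀ : ℝ) * ((E w : ℝ) * (Dw : ℝ) + 1) ≤
        (E y₀ : ℝ) * (mq w : ℝ) + (((i : ℕ) : ℝ) + 1) * (E w : ℝ) * ((E y₀ : ℝ) - 1) := by exact_mod_cast h0
    have key : ((1 - 1 / (E y₀ : ℝ)) * (((i : ℕ) : ℝ) + 1) + (-(Dw : ℝ) - 1 / (E w : ℝ)) + (mq w : ℝ) / (E w : ℝ)) *
        ((E w : ℝ) * (E y₀ : ℝ)) =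
        (E y₀ : ℝ) * (mq w : ℝ) + (((i : ℕ) : ℝ) + 1) * (E w : ℝ) * ((E y₀ : ℝ) - 1) - (E y₀ : ℝ) * ((E w : ℝ) * (Dw : ℝ) + 1) := by
      field_simp
      ring
    have h2 : 0 ≤ ((1 - 1 / (E y₀ : ℝ)) * (((i : ℕ) : ℝ) + 1) + (-(Dw : ℝ) - 1 / (E w : ℝ)) + (mq w : ℝ) / (E w : ℝ)) *
        ((E w : ℝ) * (E y₀ : ℝ)) := by rw [key]; linarith
    have h3 : 0 ≤ (1 - 1 / (E y₀ : ℝ)) * (((i : ℕ) : ℝ) + 1) + (-(Dw : ℝ) - 1 / (E w : ℝ)) + (mq w : ℝ) / (E w : ℝ) := by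
      by_contra h
      push Not at h
      linarith [mul_neg_of_neg_of_pos h hpos]
    push_cast
    linarith
  · -- the Θ-idele is carried by the slot of `y₀` (permuted image); `w` and the other companions donate
    have hs : s e = Fin.castSucc (n := (i : ℕ) + 1) (a₀ e) := if_neg hcase
    have hmin : min Dw Dy = Dy := min_eq_right (le_of_lt (not_le.mp hcase))
    rw [hs, if_neg (Fin.castSucc_ne_last (a₀ e)).symm]
    have hcomp : R y₀ ^ ((i : ℕ) + 1) * (Nn y₀ / R y₀) ≤
        ∏ b : Fin ((i : ℕ) + 1), (if Fin.castSucc (n := (i : ℕ) + 1) b = Fin.castSucc (n := (i : ℕ) + 1) (a₀ e)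
          then Nn (e (Fin.castSucc (n := (i : ℕ) + 1) b)) else R (e (Fin.castSucc (n := (i : ℕ) + 1) b))) := by
      have hg : ∀ b : Fin ((i : ℕ) + 1), R y₀ * (if b = a₀ e then Nn y₀ / R y₀ else 1) ≤
          (if Fin.castSucc (n := (i : ℕ) + 1) b = Fin.castSucc (n := (i : ℕ) + 1) (a₀ e)
            then Nn (e (Fin.castSucc (n := (i : ℕ) + 1) b)) else R (e (Fin.castSucc (n := (i : ℕ) + 1) b))) := by
        intro b
        by_cases hb : b = a₀ e
        · rw [if_pos hb, if_pos (by rw [hb]), mul_div_cancel₀ _ (hRpos y₀).ne', hb]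
        · rw [if_neg hb, if_neg (fun h => hb (Fin.castSucc_injective _ h)), mul_one]
          exact hRmono _ _ (ha₀ e b)
      calc R y₀ ^ ((i : ℕ) + 1) * (Nn y₀ / R y₀)
          = ∏ b : Fin ((i : ℕ) + 1), R y₀ * (if b = a₀ e then Nn y₀ / R y₀ else 1) := by
            rw [Finset.prod_mul_distrib, Finset.prod_const, Finset.card_univ, Fintype.card_fin, Finset.prod_ite_eq']
            simp
        _ ≤ _ := Finset.prod_le_prod (fun b _ => mul_nonneg (hR0 _) (by
              split_ifs
              · exact div_nonneg (hN0 _) (hR0 _)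
              · exact zero_le_one)) fun b _ => hg b
    refine le_trans ?_ (mul_le_mul_of_nonneg_right hcomp (hR0 w))
    -- `‖t_q(w)‖ ≤ R(y₀)^{i} · N(y₀) · R(w)` from the pair condition with `min = D_{y₀}`
    have hrew : R y₀ ^ ((i : ℕ) + 1) * (Nn y₀ / R y₀) * R w =
        ((pp : ℕ) : ℝ) ^ ((1 - 1 / (E y₀ : ℝ)) * ((i : ℕ) : ℝ) + (-(Dy : ℝ) - 1 / (E y₀ : ℝ)) + (1 - 1 / (E w : ℝ))) := by
      rw [pow_succ, mul_assoc (R y₀ ^ (i : ℕ)), mul_div_cancel₀ _ (hRpos y₀).ne', hR_eq y₀, hN_eq y₀, hR_eq w, ← hDy,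
        ← Real.rpow_natCast, ← Real.rpow_mul hp0.le, ← Real.rpow_add hp0, ← Real.rpow_add hp0]
    rw [hrew, hq_eq w]
    refine Real.rpow_le_rpow_of_exponent_le hp1 ?_
    rw [hmin] at h0
    have hR' : (E y₀ : ℝ) * ((E w : ℝ) * (Dy : ℝ) + 1) ≤
        (E y₀ : ℝ) * (mq w : ℝ) + (((i : ℕ) : ℝ) + 1) * (E w : ℝ) * ((E y₀ : ℝ) - 1) := by exact_mod_cast h0
    have key : ((1 - 1 / (E y₀ : ℝ)) * ((i : ℕ) : ℝ) + (-(Dy : ℝ) - 1 / (E y₀ : ℝ)) + (1 - 1 / (E w : ℝ)) +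
          (mq w : ℝ) / (E w : ℝ)) * ((E w : ℝ) * (E y₀ : ℝ)) =
        (E y₀ : ℝ) * (mq w : ℝ) + (((i : ℕ) : ℝ) + 1) * (E w : ℝ) * ((E y₀ : ℝ) - 1) - (E y₀ : ℝ) * ((E w : ℝ) * (Dy : ℝ) + 1) := by
      field_simp
      ring
    have h2 : 0 ≤ ((1 - 1 / (E y₀ : ℝ)) * ((i : ℕ) : ℝ) + (-(Dy : ℝ) - 1 / (E y₀ : ℝ)) + (1 - 1 / (E w : ℝ)) +
          (mq w : ℝ) / (E w : ℝ)) * ((E w : ℝ) * (E y₀ : ℝ)) := by rw [key]; linarith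
    have h3 : 0 ≤ (1 - 1 / (E y₀ : ℝ)) * ((i : ℕ) : ℝ) + (-(Dy : ℝ) - 1 / (E y₀ : ℝ)) + (1 - 1 / (E w : ℝ)) +
          (mq w : ℝ) / (E w : ℝ) := by
      by_contra h
      push Not at h
      linarith [mul_neg_of_neg_of_pos h hpos]
    linarith

end Summit.ABC.IUTFork.Thm311.Real

end
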